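import Summits.CriticalPhenomena.PercolationContinuityZ3.Theorems.PercNearOneGluingNoHeavyQuantAtomLaw
import HarnessLib

/-!
# QUANT lane R8, T-DEC: the explicit residue statement WITH THE ORDER FACTS — `ConvClosedTAtomsOrd` (census-2 g58): in each atom the
# EXPENSIVE segment starts at the LOWER low and ends at the HIGHER (or the same) absorber

builds on p205010 (kernel theorem, internal audit signed; external expert review pending)

Statement file (`--supports stmt-CriticalPhenomena-4575`), QUANT lane seat prim-quant-census-2 (gen 58), rung R8 of
`run/shared/lean/prim/quant/LADDER.md`.  One `@[conjecture]` definition and its comparison with `ConvClosedTAtoms`; standard axioms, no sorries.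

WHY A SECOND STATEMENT.  `ConvClosedTAtoms` (`…QuantAtomLaw`, p325790) quantifies over ALL admissible data (`AtomData`: distinct lows, `c₂ < u < c₁`).
Two order facts cut this family down to census-2 g56's atlas exactly: **(O1) `l₁ < l₂`** — the expensive low is the lower one — holds for EVERY
window-DEC atom without a datum free of light straddlers (the cheap segment straddles, and at the layer just below its absorber the law cannot be
shipped: `usage` is antitone in the low, file `…QuantAtomLightSlice`), and **(O2) `h₂ ≤ h₁`** — the cheap segment ends at the lower absorber
(Type II "crossed", never "parallel") — holds at every EXTREME point because the two segments are segments of ONE corner run, whose support is a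
staircase (file `…QuantWindowExtremeShape`, `corner_staircase`).  (O2) is NOT a consequence of window-DEC alone: exact census (this seat,
code/atomorder.py, M ≤ 7, 11 floors): 39 471 window-DEC non-BDEC admissible atoms, (O1) fails 0 times, (O2) fails 8 729 times (e.g. x = 1/4,
T = 5/2, j = M = 4, segments (0,3) expensive and (1,4) cheap) — those laws are window-DEC but not extreme.  The reduction
`convClosedT_of_atomPairsOrd : ConvClosedTAtomsOrd → ConvClosedT` (file `…QuantConvAtomsReduction`) therefore goes through the extreme points.
For census-1's LS-CORE catalogue this means: Type I ⊗ Type I and CROSSED Type II only, expensive low below the cheap low — the nine role patterns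
of CONV-RESIDUE-G21 §8 (5) are the whole list.

* `LawDec.ConvClosedTAtomsOrd` (`@[conjecture]`) — `ConvClosedTAtoms` with the extra hypotheses `l₁ < l₁′`, `h₁′ ≤ h₁`, `l₂ < l₂′`, `h₂′ ≤ h₂`.
* `LawDec.convClosedTAtomsOrd_of_atoms : ConvClosedTAtoms → ConvClosedTAtomsOrd` (trivial weakening).

[this work]; nothing here is cited as a published result.  The gluing rows served [cite: KozmaNitzan2024, Conjecture 3 (p. 15)]; product
measure [cite: Grimmett1999, §1.3 p. 10].
-/

noncomputable section

namespace Summit.CriticalPhenomena.PercolationContinuityZ3.Theorems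

namespace Quant

open Finset

namespace LawDec

/-- **CONJECTURE `ConvClosedT` FOR ORDERED ATOM ⊗ ATOM (census-2 g58)** — `ConvClosedTAtoms` restricted to the data that actually occur at
extreme points of the window polytope: in each factor the expensive segment `(l, h)` and the cheap segment `(l′, h′)` satisfy `l < l′` and
`h′ ≤ h` (Type I: `h′ = h`; Type II: crossed).  Implies `ConvClosedT` (`convClosedT_of_atomPairsOrd`).  EVIDENCE: as for `ConvClosedTAtoms`
(census-2 g56 kit j149400, census-1 g21 kit j154424/j155785, lead g26 D¼: 0 failures; exactly tight pairs exist). [this work] [status: open] -/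
@[conjecture] def ConvClosedTAtomsOrd : Prop :=
  ∀ (x T₁ T₂ : ℝ) (M₁ M₂ j : ℕ) (l₁ h₁ l₁' h₁' l₂ h₂ l₂' h₂' : ℕ),
    0 < x → x < 1 → j < M₁ + M₂ →
    AtomData x T₁ j M₁ l₁ h₁ l₁' h₁' → AtomData x T₂ j M₂ l₂ h₂ l₂' h₂' →
    l₁ < l₁' → h₁' ≤ h₁ → l₂ < l₂' → h₂' ≤ h₂ →
    (∀ j'', j'' ≤ j → j ≤ j'' + M₂ → DECAtT x T₁ j'' M₁ (atomLaw x T₁ j l₁ h₁ l₁' h₁')) →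
    (∀ j'', j'' ≤ j → j ≤ j'' + M₁ → DECAtT x T₂ j'' M₂ (atomLaw x T₂ j l₂ h₂ l₂' h₂')) →
    ¬ BDECAtT x T₁ j M₁ M₂ (atomLaw x T₁ j l₁ h₁ l₁' h₁') → ¬ BDECAtT x T₂ j M₂ M₁ (atomLaw x T₂ j l₂ h₂ l₂' h₂') →
    DECAtT x (T₁ + T₂) j (M₁ + M₂) (lconv M₁ M₂ (atomLaw x T₁ j l₁ h₁ l₁' h₁') (atomLaw x T₂ j l₂ h₂ l₂' h₂'))

/-- the ordered statement is a weakening of `ConvClosedTAtoms`. [this work] -/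
theorem convClosedTAtomsOrd_of_atoms (hA : ConvClosedTAtoms) : ConvClosedTAtomsOrd :=
  fun x T₁ T₂ M₁ M₂ j l₁ h₁ l₁' h₁' l₂ h₂ l₂' h₂' hx0 hx1 hj hd₁ hd₂ _ _ _ _ hw₁ hw₂ hb₁ hb₂ =>
    hA x T₁ T₂ M₁ M₂ j l₁ h₁ l₁' h₁' l₂ h₂ l₂' h₂' hx0 hx1 hj hd₁ hd₂ hw₁ hw₂ hb₁ hb₂

end LawDec

end Quant

end Summit.CriticalPhenomena.PercolationContinuityZ3.Theorems
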